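import Literature.AlgebraicGeometry.AbelianSchemes.SymplecticLiftOfIsogeny
import Literature.AlgebraicGeometry.Motives.AbelianVarietyWeilPairingAlongIsogeny
import Literature.AlgebraicGeometry.Motives.BijectiveMorphismIsoGeneral
import Literature.AlgebraicGeometry.Morphisms.GeometricPointsLiftSurjective
import HarnessLib

/-!
# The `symplectic` field of a Hecke isogeny quotient from the DIVISOR clause `D_Q(ψ^*Θ_B) ∼ ν·D_Q(Θ_A)`
# ([Lan2013PELCompactifications] §1.3.6; [MumfordAV1970] §20, §23; [Deligne1971TravauxShimura] 4.11–4.12)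

[MumfordAV1970, §20 property (3) of `e_n` (p. 186) and §23 Thm. 2 (p. 231)]: for an isogeny `ψ : A → B` and a
polarisation `λ_B` of `B` with `ψ^∨ ∘ λ_B ∘ ψ = ν·λ_A`, the Weil pairings satisfy `ē^{λ_B}(ψa, ψb) = ē^{λ_A}(a, b)` read at
the right levels; the tree's algebraic form is ★ `AbelianVariety.weilPairingLevel_map_map_eq_of_mixedLevel`
(`Motives/AbelianVarietyWeilPairingAlongIsogeny`): the MIXED-LEVEL clause (W′) `ē^{Θ_B}_M(ψa, ψb) = ē^{Θ_A}_{νM}(a, b)`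
(`a, b ∈ A[νM]`, `ψa, ψb ∈ B[M]`) follows from the DIVISOR CLAUSE `D_Q(ψ^*Θ_B) ∼ ν·D_Q(Θ_A)` for all points `Q`
(`D_Q(Θ) = t_Q^*Θ − Θ`, ★ `weilDiv`), granted divisibility of points and dominance of the `[n]`.

THIS FILE composes it with ★ (T3) `LevelStructure.IsSymplecticLiftable.of_fibreIsogeny` (`SymplecticLiftOfIsogeny`), and
DISCHARGES every side condition of (W′) at a geometric point carrying a symplectic lift (algebraically closed `Ω`, no
positive integer vanishing in `Ω` by ★ `SymplecticLift.natCast_ne_zero`):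
* `AbelianVariety.pow_surjective_of_cast_ne_zero` — `P ↦ P^n` is ONTO on `Ω`-points of an abelian variety over an
  algebraically closed field with `(n : Ω) ≠ 0` (`[n]` is an isogeny, ★ `isIsogeny_zsmul_id_of_cast_ne_zero`, and geometric
  points lift along surjective morphisms, ★ `Morphisms.exists_over_comp_eq_of_surjective`) — [MumfordAV1970, §6 App. 2
  (p. 62)] «`n_X` is surjective»; the tree had it over `ℂ` only (★ `pow_surjective`);
* `LevelStructure.IsSymplecticLiftable.of_fibreIsogeny_of_weilDiv_linEquiv` — **the `symplectic` field of the quotient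
  triple from the divisor clause**: hypotheses of ★ `of_fibreIsogeny` with its polarisation transfer `hpol` replaced by
  «every ample `IsLambdaOfAt` witness `Θ_B` of `λ̄_B` at `s` has an ample witness `Θ_A` of `λ̄_A` with
  `D_Q((u_s)^*Θ_B) ∼ ν·D_Q(Θ_A)` for all `Q ∈ A_s(Ω)`», plus «`u_s` onto on `Ω`-points» (the quotient map is);
* `LevelStructure.exists_isSymplecticLiftable_of_fibreIsogeny_of_weilDiv_linEquiv` — with ★ H3, the `level` and
  `symplectic` fields in one call.
What remains for the Hecke-link quotient (the (γ2) closer, other hands' bricks): the divisor clause from the descent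
identity `ψ^∨ ≫ λ_B ≫ ψ = ν • λ_A` of the quotient polarisation and the two `IsLambdaOfAt` witnesses.  Theorems only; cell
hodgecm-mathlib, seat B-p04 (g17), E-road HECKE-LINK socket (B) (γ1).  HC_CM is proved only modulo the 7 printed
citations until rung 0 closes; this file discharges none of them.

## References
* [Lan2013PELCompactifications] K.-W. Lan, *Arithmetic compactifications of PEL-type Shimura varieties* (2013), §1.3.6
  Def. 1.3.6.2 (p. 80), Lemma 1.3.6.6 and Cor. 1.3.6.7 (pp. 81–82).
* [MumfordAV1970] D. Mumford, *Abelian Varieties* (1970), §6 App. 2 (p. 62), §20 (3) (p. 186), §23 Thm. 2 (p. 231).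
* [Deligne1971TravauxShimura] P. Deligne, *Travaux de Shimura* (1971), 4.11–4.12 (pp. 148–149).
* [GortzWedhorn2023] U. Görtz, T. Wedhorn, *Algebraic Geometry II* (2023), Prop. 27.186–27.187 (`[n]` is an isogeny).
-/

noncomputable section

universe u

open CategoryTheory CategoryTheory.Limits AlgebraicGeometry MonoidalCategory Matrix
open scoped MonObj

namespace Literature.AlgebraicGeometry.Motives.AbelianVariety

/-! ### §0 Divisibility of `Ω`-points of an abelian variety over an algebraically closed field -/

/-- **`P ↦ P^n` is onto on `A(Ω)`** for an abelian variety over an ALGEBRAICALLY CLOSED field `Ω` with `(n : Ω) ≠ 0`: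
`[n]_A` is an isogeny (★ `isIsogeny_zsmul_id_of_cast_ne_zero`), hence surjective, and `Ω`-points lift along surjective
morphisms locally of finite type (★ `Morphisms.exists_over_comp_eq_of_surjective`).  [MumfordAV1970] §6 App. 2: «`n_X` is
surjective». [cite: MumfordAV1970, §6 Application 2 (p. 62)] [cite: GortzWedhorn2023, Prop. 27.186 and Prop. 27.187] -/
theorem pow_surjective_of_cast_ne_zero {Ω : Type u} [Field Ω] [IsAlgClosed Ω] (A : AbelianVariety Ω) {n : ℕ}
    (hn : (n : Ω) ≠ 0) : Function.Surjective fun P : A.Points Ω => P ^ n := by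
  have hiso := A.isIsogeny_zsmul_id_of_cast_ne_zero (n : ℤ) (by exact_mod_cast hn)
  haveI : Surjective (((n : ℤ) • 𝟙 A :).hom.hom.hom).left := hiso.1
  haveI : LocallyOfFiniteType (((n : ℤ) • 𝟙 A :).hom.hom.hom).left := locallyOfFiniteType_left _
  intro P
  obtain ⟨R, hR⟩ := Morphisms.exists_over_comp_eq_of_surjective ((n : ℤ) • 𝟙 A :).hom.hom.hom
    (Spec.map (CommRingCat.ofHom (algebraMap Ω Ω))) P
  refine ⟨R, ?_⟩
  change R ^ n = P
  rw [← zpow_natCast, zpow_eq_comp_zsmul_id R (n : ℤ)]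
  exact hR

end Literature.AlgebraicGeometry.Motives.AbelianVariety

namespace Literature.AlgebraicGeometry.AbelianSchemes

namespace AbelianSchemeOver

open Literature.AlgebraicGeometry.Motives
open Literature.AlgebraicGeometry.ModuliOfAbelianVarieties (typeForm)

variable {S : Scheme.{u}} {A B : AbelianSchemeOver S}

/-! ### §1 The `symplectic` field of the quotient triple from the divisor clause -/

/-- **(T3) FROM THE DIVISOR CLAUSE**: symplectic-liftability transfers along a Hecke isogeny `u : A → B` (★
`IsSymplecticLiftable.of_fibreIsogeny`) when, at every geometric point, every ample `IsLambdaOfAt` witness `Θ_B` of the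
target polarisation admits an ample witness `Θ_A` of the source polarisation with the DIVISOR CLAUSE
`D_Q((u_s)^*Θ_B) ∼ ν·D_Q(Θ_A)` (all `Q ∈ A_s(Ω)`) — the mixed-level Weil clause (W′) is then ★
`weilPairingLevel_map_map_eq_of_mixedLevel`, its side conditions (dominance of `u_s` and of the `[n]`, divisibility of
`Ω`-points) being automatic at an algebraically closed point carrying a symplectic lift (`u_s` onto on `Ω`-points by
`hsurj`). [cite: Lan2013PELCompactifications, §1.3.6 Lemma 1.3.6.6 and Cor. 1.3.6.7 (pp. 81–82)]
[cite: MumfordAV1970, §20 (property (3) of e_n, p. 186)] [cite: Deligne1971TravauxShimura, 4.11–4.12 pp. 148–149] -/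
theorem LevelStructure.IsSymplecticLiftable.of_fibreIsogeny_of_weilDiv_linEquiv {g N ν : ℕ} (hN : N ≠ 0) (hν : ν ≠ 0)
    {φ' : A.LevelStructure g (N * ν)} {DA : A.DualPair} {polA : A.Polarization DA}
    {DB : B.DualPair} {polB : B.Polarization DB} {δ : Fin g → ℕ}
    (u : A.X ⟶ B.X) [IsMonHom u] {ψφ : B.LevelStructure g N} (hψφ : ∀ i, ψφ.σ i = (φ'.σ i ^ ν) ≫ u)
    (hB : B.IsOfRelDim g)
    (γm γs : Matrix (Fin g ⊕ Fin g) (Fin g ⊕ Fin g) ℤ) (hγ : γm * γs = (ν : ℤ) • (1 : Matrix _ _ ℤ))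
    (hγ' : γs * γm = (ν : ℤ) • (1 : Matrix _ _ ℤ)) (hsim : γsᵀ * typeForm δ * γs = (ν : ℤ) • typeForm δ)
    (hQA4 : ∀ k i, (N : ℤ) ∣ (γm - 1) k i)
    (hsurj : ∀ (Ω : Type u) [Field Ω] [IsAlgClosed Ω] (s : Spec (.of Ω) ⟶ S),
      Function.Surjective (AlgPoints.map (L := Ω) (fibreHom u s).hom.hom.hom))
    (hker : ∀ (Ω : Type u) [Field Ω] [IsAlgClosed Ω] (s : Spec (.of Ω) ⟶ S)
      (P : (A.fibre s).toAbelianVariety.Points Ω), AlgPoints.map (fibreHom u s).hom.hom.hom P = 1 ↔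
        ∃ z : Fin g ⊕ Fin g → ℤ,
          P = A.restrictPt s (φ'.section_ fun j => ((((N : ℤ) * (γs *ᵥ z) j : ℤ)) : ZMod (N * ν))))
    (hpol : ∀ (Ω : Type u) [Field Ω] [IsAlgClosed Ω] (s : Spec (.of Ω) ⟶ S)
      [IsDominant (AbelianVariety.Hom.toSchemeHom (fibreHom u s))]
      (ΘB : CartierDivisor (B.fibre s).toAbelianVariety.X.left), ΘB.IsAmple → B.IsLambdaOfAt s DB polB.lam ΘB →
      ∃ ΘA : CartierDivisor (A.fibre s).toAbelianVariety.X.left, ΘA.IsAmple ∧ A.IsLambdaOfAt s DA polA.lam ΘA ∧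
        ∀ Q : (A.fibre s).toAbelianVariety.Points Ω,
          ((A.fibre s).toAbelianVariety.weilDiv
              (ΘB.pullback (AbelianVariety.Hom.toSchemeHom (fibreHom u s))) Q).LinEquiv
            (ν • (A.fibre s).toAbelianVariety.weilDiv ΘA Q))
    (h : φ'.IsSymplecticLiftable polA δ) : ψφ.IsSymplecticLiftable polB δ := by
  intro Ω _ _ s ΘB hΘB hlamB
  -- dominance of `u_s` (onto on `Ω`-points of the finite-type `B_s`)
  haveI : IsDominant (AbelianVariety.Hom.toSchemeHom (fibreHom u s)) :=
    isDominant_of_surjective_map (fibreHom u s).hom.hom.hom (hsurj Ω s)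
  obtain ⟨ΘA, hΘA, hlamA, hφ⟩ := hpol Ω s ΘB hΘB hlamB
  obtain ⟨Λ⟩ := h Ω s ΘA hΘA hlamA
  have hNν : N * ν ≠ 0 := Nat.mul_ne_zero hN hν
  refine Λ.nonempty_of_isogeny hN hν u hψφ hB γm γs hγ hγ' hsim hQA4 (hker Ω s) ?_
  intro M hNM hMΩ hνMΩ a b P Q hP hQ
  have hM : M ≠ 0 := by rintro rfl; exact hMΩ (by rw [Nat.cast_zero])
  have hνΩ : (ν : Ω) ≠ 0 := Λ.natCast_ne_zero hNν hν
  haveI := AbelianVariety.isDominant_toSchemeHom_zsmul_of_ne_zero (B.fibre s).toAbelianVariety hMΩ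
  haveI := AbelianVariety.isDominant_toSchemeHom_zsmul_of_ne_zero (B.fibre s).toAbelianVariety hνΩ
  haveI := AbelianVariety.isDominant_toSchemeHom_zsmul_of_ne_zero (A.fibre s).toAbelianVariety hνMΩ
  haveI := AbelianVariety.isDominant_toSchemeHom_zsmul_of_ne_zero (B.fibre s).toAbelianVariety hνMΩ
  exact AbelianVariety.weilPairingLevel_map_map_eq_of_mixedLevel (fibreHom u s) ΘA ΘB hφ
    ((A.fibre s).toAbelianVariety.pow_surjective_of_cast_ne_zero hνΩ)
    ((B.fibre s).toAbelianVariety.pow_surjective_of_cast_ne_zero hνMΩ) a b P Q hP hQ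

/-- **The `level` and `symplectic` fields of a Hecke isogeny quotient from the divisor clause, in one call** (★ H3
`exists_σ_eq_pow_comp_of_coprime` + `of_fibreIsogeny_of_weilDiv_linEquiv`): a symplectic-liftable level-`N·ν` structure
`φ′` on `A` yields a level-`N` structure `ψ` on `B` with `ψ.σ i = (φ′.σ i ^ ν) ≫ u`, symplectic-liftable of type `δ`
for `λ_B`. [cite: Lan2013PELCompactifications, §1.3.6 Def. 1.3.6.2 (p. 80), Lemma 1.3.6.6 and Cor. 1.3.6.7 (pp. 81–82)]
[cite: MumfordFogartyKirwan1994, Ch. 7 §1 Definition 7.1 (p. 129) and App. 7A (p. 235)] -/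
theorem LevelStructure.exists_isSymplecticLiftable_of_fibreIsogeny_of_weilDiv_linEquiv {g N ν : ℕ} (hN : N ≠ 0)
    (hν : ν ≠ 0) {φ' : A.LevelStructure g (N * ν)} {DA : A.DualPair} {polA : A.Polarization DA}
    {DB : B.DualPair} {polB : B.Polarization DB} {δ : Fin g → ℕ}
    (u : A.X ⟶ B.X) [IsMonHom u] (hcop : Nat.Coprime ν N)
    (hsurjF : ∀ ⦃Ω : Type u⦄ [Field Ω] [IsAlgClosed Ω] (s : Spec (.of Ω) ⟶ S) (y : B.FibrePoints s),
      ∃ x : A.FibrePoints s, x ≫ u = y)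
    (hkerν : ∀ ⦃Ω : Type u⦄ [Field Ω] [IsAlgClosed Ω] (s : Spec (.of Ω) ⟶ S) (x : A.FibrePoints s),
      x ≫ u = 1 → x ^ ν = 1)
    (hB : B.IsOfRelDim g)
    (γm γs : Matrix (Fin g ⊕ Fin g) (Fin g ⊕ Fin g) ℤ) (hγ : γm * γs = (ν : ℤ) • (1 : Matrix _ _ ℤ))
    (hγ' : γs * γm = (ν : ℤ) • (1 : Matrix _ _ ℤ)) (hsim : γsᵀ * typeForm δ * γs = (ν : ℤ) • typeForm δ)
    (hQA4 : ∀ k i, (N : ℤ) ∣ (γm - 1) k i)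
    (hsurj : ∀ (Ω : Type u) [Field Ω] [IsAlgClosed Ω] (s : Spec (.of Ω) ⟶ S),
      Function.Surjective (AlgPoints.map (L := Ω) (fibreHom u s).hom.hom.hom))
    (hker : ∀ (Ω : Type u) [Field Ω] [IsAlgClosed Ω] (s : Spec (.of Ω) ⟶ S)
      (P : (A.fibre s).toAbelianVariety.Points Ω), AlgPoints.map (fibreHom u s).hom.hom.hom P = 1 ↔
        ∃ z : Fin g ⊕ Fin g → ℤ,
          P = A.restrictPt s (φ'.section_ fun j => ((((N : ℤ) * (γs *ᵥ z) j : ℤ)) : ZMod (N * ν))))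
    (hpol : ∀ (Ω : Type u) [Field Ω] [IsAlgClosed Ω] (s : Spec (.of Ω) ⟶ S)
      [IsDominant (AbelianVariety.Hom.toSchemeHom (fibreHom u s))]
      (ΘB : CartierDivisor (B.fibre s).toAbelianVariety.X.left), ΘB.IsAmple → B.IsLambdaOfAt s DB polB.lam ΘB →
      ∃ ΘA : CartierDivisor (A.fibre s).toAbelianVariety.X.left, ΘA.IsAmple ∧ A.IsLambdaOfAt s DA polA.lam ΘA ∧
        ∀ Q : (A.fibre s).toAbelianVariety.Points Ω,
          ((A.fibre s).toAbelianVariety.weilDiv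
              (ΘB.pullback (AbelianVariety.Hom.toSchemeHom (fibreHom u s))) Q).LinEquiv
            (ν • (A.fibre s).toAbelianVariety.weilDiv ΘA Q))
    (h : φ'.IsSymplecticLiftable polA δ) :
    ∃ ψ : B.LevelStructure g N, (∀ i, ψ.σ i = (φ'.σ i ^ ν) ≫ u) ∧ ψ.IsSymplecticLiftable polB δ := by
  obtain ⟨ψ, hψ⟩ := φ'.exists_σ_eq_pow_comp_of_coprime (Nat.mul_ne_zero hN hν) u hcop hsurjF hkerν
  exact ⟨ψ, hψ, LevelStructure.IsSymplecticLiftable.of_fibreIsogeny_of_weilDiv_linEquiv hN hν u hψ hB γm γs hγ hγ' hsim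
    hQA4 hsurj hker hpol h⟩

end AbelianSchemeOver

end Literature.AlgebraicGeometry.AbelianSchemes

end
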